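import Literature.Analysis.FluidPDE.BackwardEnergyUniqueness
import HarnessLib

/-!
# Backward uniqueness of classical Navier–Stokes flows on `ℝ³` under finite-order decay of the
# difference (Temam 1997, Ch. III §6; Bardos–Tartar 1973) — the assembly with explicit bounds

Analysis/FluidPDE proof file (theorems only: no definition, no named fact), a companion of
`Literature.Analysis.FluidPDE.BackwardEnergyUniqueness` (Temam, *Infinite-Dimensional Dynamical
Systems in Mechanics and Physics*, 2nd ed. 1997, Ch. III §6: Lemma 6.1 (6.9)–(6.11), Lemma 6.2
(6.12)–(6.14), §6.2 (6.16)–(6.17), pp. 172–175; the log-convexity method of Bardos–Tartar 1973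
and Ghidaglia 1986, Remark 6.1 there).

That file proves backward uniqueness for the perturbed Stokes structure
`∂ₜw = νΔw − ∇q + f`, `‖f‖ ≤ a‖∇w‖ + b‖w‖`, `div w = 0` on `[0, T] × ℝ³`
(`eq_zero_of_perturbedStokes_backward`) and for two classical Navier–Stokes flows
(`IsClassicalNSSolutionOn.backward_unique`) under the hypothesis that the fields have UNIFORM
RAPID DECAY on the slab (`HasUniformRapidDecayOn`: every space–time derivative decays faster than
every power of `|x|`, uniformly in `t`). Its proof, however, extracts from that hypothesis only six
uniform polynomial bounds — on `w`, `∇w`, `∇²w`, `∇³w`, `∂ₜw`, `∇∂ₜw`, all `≤ C(1 + |x|)^{-5}` —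
and its fixed-time lemmas (`neg_two_integral_inner_timeDeriv_eq/_le`, `dirichletQuotient_ineq`)
are already stated for any exponent `r > 4`. This file records the SAME assembly with those six
bounds as the hypotheses, for any `r > 4` and for the DIFFERENCE of the two flows only, the two
background flows entering only through `sup |u₁| ≤ A` and `sup |∇u₂| ≤ B` on the open slab
(Temam's `k = k(‖u‖_∞, ‖∇v‖_∞)` in (6.17)):

* `eq_zero_of_perturbedStokes_backward_of_decay` — Lemma 6.2 for the perturbed Stokes structure
  under the six bounds (proof = the proof of `eq_zero_of_perturbedStokes_backward` from the point
  where the bounds have been extracted, with `5` replaced by `r`);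
* `linearisedNS_backward_unique_of_decay` — the case `f = −(U₁·∇)w − (w·∇)U₂`, `‖U₁‖ ≤ A`,
  `‖∇U₂‖ ≤ B`;
* `IsClassicalNSSolutionOn.backward_unique_of_decay` — two classical solutions of the forced
  Navier–Stokes equations on `[0, T] × ℝ³` (same `ν > 0`, same force), `u₁` bounded and `∇u₂`
  bounded on `(0, T) × ℝ³`, whose difference obeys the six bounds, and which agree at time `T`,
  agree on `[0, T]`;
* `IsClassicalNSSolutionOn.backward_unique_of_decay_symm` — the same with the symmetric
  hypothesis "both flows bounded with bounded gradient" (the form asked for by consumers).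

Why the weaker hypothesis matters: a Navier–Stokes flow issued from rapidly decaying data does
not, in general, keep rapid decay at positive times (instantaneous spatial spreading: generic
decay `|x|^{-4}` of the velocity), so `HasUniformRapidDecayOn` on a slab is a strong restriction
on genuine flows, whereas polynomial bounds of finite order on a difference are what a decay
analysis actually delivers. Honest scope: the exponent must exceed `4 = dim + 1` (inherited from
the fixed-time lemmas: integrability margins for the pressure and boundary terms), which the
generic `|x|^{-4}` profile itself just fails; the bounds are required on the CLOSED slab (they give
the continuity of the energy at the end points). Nothing here is specific to Navier–Stokes
beyond §5; the abstract Hilbert-space theorem is `Literature.Analysis.ODE.eq_zero_of_abstractParabolic_backward`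
(`ODE/AbstractParabolicBackwardUniqueness.lean`).

## Mathlib / tree search

Reused by name from `BackwardEnergyUniqueness.lean`: `LogConvexity.eq_zero_of_backward`,
`neg_two_integral_inner_timeDeriv_le`, `dirichletQuotient_ineq`, `linearisedNS`-style algebra;
from `EnergyUniqueness.lean`: `laplacian_sub_apply_of_contDiff`, `gradient_sub_apply`;
`RapidDecayLemmas.rpow_neg_le_one`, `VectorCalculus.frobeniusNormSq_eq_sum`,
`IsSmoothSpaceTimeOn.hasDerivAt_fderiv_slice_timeDerivWithin`, Mathlib's
`integrable_one_add_norm`, `hasDerivAt_integral_of_dominated_loc_of_deriv_le`.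
`lean search 'backward_unique_of_decay|perturbedStokes_backward_of'`: nothing (2026-08-27). The
private real-arithmetic step `LogConvexity.quotient_aux` of the source file is private there and is
re-proved here verbatim (`quotient_aux'`).

## References

* R. Temam, *Infinite-Dimensional Dynamical Systems in Mechanics and Physics*, 2nd ed.,
  Springer 1997, Ch. III §6: Lemma 6.1, Lemma 6.2, Remark 6.1, §6.2 (pp. 171–175). [Temam1997]
* C. Bardos, L. Tartar, *Sur l'unicité rétrograde des équations paraboliques et quelques
  questions voisines*, Arch. Rational Mech. Anal. 50 (1973) 10–25. [BardosTartar1973]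
* I. Kukavica, *Log-log convexity and backward uniqueness*, Proc. AMS 135 (2007) 2415–2421,
  Thm. 2.1 (the abstract statement). [Kukavica2007]
-/

noncomputable section

open MeasureTheory Set Function Filter Metric
open _root_.Topology
open scoped RealInnerProductSpace NNReal ENNReal ContDiff

namespace Literature.Analysis.FluidPDE

/-! ### §1. Real arithmetic of Lemma 6.1 at the Dirichlet quotient -/

/-- Real arithmetic of Lemma 6.1 at the Dirichlet quotient `l = G/E` (`E > 0`): from
`ν(ψ − lφ) ≤ a²G + b²E − 2ν²l(G − lE)` (whose last term vanishes at `l = G/E`) we get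
`ψE − Gφ ≤ K(G + E)E` with `K = 2ν + a + 2b + (a² + b²)/ν + 1` (verbatim the private
`LogConvexity.quotient_aux` of `BackwardEnergyUniqueness.lean`). [folklore] -/
private theorem quotient_aux' {ν a b ψ φ G E : ℝ} (hν : 0 < ν) (hE : 0 < E)
    (hG : 0 ≤ G) (ha : 0 ≤ a) (hb : 0 ≤ b)
    (h : ν * (ψ - G / E * φ) ≤
      a ^ 2 * G + b ^ 2 * E - 2 * ν ^ 2 * (G / E) * (G - G / E * E)) :
    ψ * E - G * φ ≤ (2 * ν + a + 2 * b + (a ^ 2 + b ^ 2) / ν + 1) * (G + E) * E := by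
  have hl : G - G / E * E = 0 := by rw [div_mul_cancel₀ G hE.ne']; ring
  rw [hl, mul_zero, sub_zero] at h
  have hψl : (ψ - G / E * φ) * E = ψ * E - G * φ := by
    rw [sub_mul, div_mul_eq_mul_div, div_mul_cancel₀ _ hE.ne']
  rw [← hψl]
  have hstep : ψ - G / E * φ ≤ (a ^ 2 * G + b ^ 2 * E) / ν := by
    rw [le_div_iff₀ hν]; linarith
  have hnum : a ^ 2 * G + b ^ 2 * E ≤ (a ^ 2 + b ^ 2) * (G + E) := by
    nlinarith [mul_nonneg (sq_nonneg b) hG, mul_nonneg (sq_nonneg a) hE.le]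
  have hKc1 : (a ^ 2 * G + b ^ 2 * E) / ν ≤
      (2 * ν + a + 2 * b + (a ^ 2 + b ^ 2) / ν + 1) * (G + E) :=
    calc (a ^ 2 * G + b ^ 2 * E) / ν ≤ (a ^ 2 + b ^ 2) * (G + E) / ν :=
          div_le_div_of_nonneg_right hnum hν.le
      _ = (a ^ 2 + b ^ 2) / ν * (G + E) := by ring
      _ ≤ (2 * ν + a + 2 * b + (a ^ 2 + b ^ 2) / ν + 1) * (G + E) := by
          have h0 : 0 ≤ (2 * ν + a + 2 * b + 1) * (G + E) := by positivity
          linarith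
  exact mul_le_mul_of_nonneg_right (hstep.trans hKc1) hE.le

/-! ### §2. Lemma 6.2 for the perturbed Stokes structure under six uniform decay bounds -/

section Assembly

open InnerProductSpace
open scoped Laplacian

/-- **Backward uniqueness for the perturbed Stokes structure under finite-order decay (Temam 1997,
Ch. III, Lemma 6.2, whole-space classical rendering).** Let `w : [0, T] × ℝ³ → ℝ³` be jointly
smooth with divergence-free slices, and suppose that on the open time interval it solves
`∂ₜw = νΔw − ∇q + f` with `ν > 0`, `q(t) ∈ C¹` and `‖f(t,x)‖ ≤ a‖∇w(t,x)‖ + b‖w(t,x)‖`. Assume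
the six uniform polynomial bounds `‖w‖, ‖∇w‖, ‖∇²w‖, ‖∇³w‖, ‖∂ₜw‖, ‖∇∂ₜw‖ ≤ C(1 + |x|)^{-r}` on
`[0, T] × ℝ³` for some `r > 4` (`∂ₜ` = the time derivative within `[0, T]`). If `w(T) = 0` then
`w ≡ 0` on `[0, T] × ℝ³`. Proof: verbatim that of `eq_zero_of_perturbedStokes_backward` (there
the six bounds are first extracted from uniform rapid decay with `r = 5`): `E(t) = ‖w(t)‖₂²`,
`G(t) = ‖∇w(t)‖₂²` are continuous on `[0, T]` and differentiable on `(0, T)` by dominated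
differentiation under the integral sign, and the fixed-time inequalities
`neg_two_integral_inner_timeDeriv_le` ((6.14)) and `dirichletQuotient_ineq` (Lemma 6.1) feed
`LogConvexity.eq_zero_of_backward` (Lemma 6.2). [cite: Temam1997, Ch. III §6, Lemma 6.2 with Lemma 6.1 and §6.2 (pp. 172–175)] -/
theorem eq_zero_of_perturbedStokes_backward_of_decay {T ν a b C r : ℝ} (hT : 0 < T) (hν : 0 < ν)
    (ha : 0 ≤ a) (hb : 0 ≤ b) (hC : 0 ≤ C) (hr : 4 < r)
    {w f : ℝ → EuclideanSpace ℝ (Fin 3) → EuclideanSpace ℝ (Fin 3)}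
    {q : ℝ → EuclideanSpace ℝ (Fin 3) → ℝ}
    (hw : IsSmoothSpaceTimeOn (Icc 0 T) w)
    (h0 : ∀ t ∈ Icc 0 T, ∀ x, ‖w t x‖ ≤ C * (1 + ‖x‖) ^ (-r))
    (h1 : ∀ t ∈ Icc 0 T, ∀ x, ‖fderiv ℝ (w t) x‖ ≤ C * (1 + ‖x‖) ^ (-r))
    (h2 : ∀ t ∈ Icc 0 T, ∀ x, ‖fderiv ℝ (fderiv ℝ (w t)) x‖ ≤ C * (1 + ‖x‖) ^ (-r))
    (h3 : ∀ t ∈ Icc 0 T, ∀ x, ‖iteratedFDeriv ℝ 3 (w t) x‖ ≤ C * (1 + ‖x‖) ^ (-r))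
    (ht : ∀ t ∈ Icc 0 T, ∀ x, ‖timeDerivWithin (Icc 0 T) w t x‖ ≤ C * (1 + ‖x‖) ^ (-r))
    (ht1 : ∀ t ∈ Icc 0 T, ∀ x,
      ‖fderiv ℝ (timeDerivWithin (Icc 0 T) w t) x‖ ≤ C * (1 + ‖x‖) ^ (-r))
    (hq : ∀ t ∈ Ioo 0 T, ContDiff ℝ 1 (q t))
    (hdiv : ∀ t ∈ Ioo 0 T, VectorCalculus.IsDivFree (w t))
    (heq : ∀ t ∈ Ioo 0 T, ∀ x,
      timeDerivWithin (Icc 0 T) w t x = ν • (Δ (w t)) x - gradient (q t) x + f t x)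
    (hf : ∀ t ∈ Ioo 0 T, ∀ x, ‖f t x‖ ≤ a * ‖fderiv ℝ (w t) x‖ + b * ‖w t x‖)
    (hfin : ∀ x, w T x = 0) : ∀ t ∈ Icc 0 T, ∀ x, w t x = 0 := by
  set S : Set ℝ := Icc 0 T with hS_def
  have hS : UniqueDiffOn ℝ S := uniqueDiffOn_Icc hT
  set e := EuclideanSpace.basisFun (Fin 3) ℝ with he
  set w' : ℝ → EuclideanSpace ℝ (Fin 3) → EuclideanSpace ℝ (Fin 3) := timeDerivWithin S w
    with hw'_def
  have hw'sm : IsSmoothSpaceTimeOn S w' := hw.timeDerivWithin hS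
  have hr3 : (Module.finrank ℝ (EuclideanSpace ℝ (Fin 3)) : ℝ) < r := by
    rw [finrank_euclideanSpace_fin]; push_cast; linarith
  have hK0 : (0 : ℝ) ≤ r := by linarith
  -- ## regularity of slices
  have hwc : ∀ s ∈ S, Continuous (w s) := fun s hs => hw.continuous_slice hs
  have hw3 : ∀ s ∈ S, ContDiff ℝ 3 (w s) := fun s hs => contDiff_infty.1 (hw.contDiff_slice hs) 3
  have hw2 : ∀ s ∈ S, ContDiff ℝ 2 (w s) := fun s hs => (hw3 s hs).of_le (by norm_num)
  have hw1 : ∀ s ∈ S, ContDiff ℝ 1 (w s) := fun s hs => (hw3 s hs).of_le (by norm_num)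
  have hw'1 : ∀ s ∈ S, ContDiff ℝ 1 (w' s) := fun s hs =>
    contDiff_infty.1 (hw'sm.contDiff_slice hs) 1
  have hw'c : ∀ s ∈ S, Continuous (w' s) := fun s hs => hw'sm.continuous_slice hs
  have hDwc : ∀ s ∈ S, Continuous (fderiv ℝ (w s)) := fun s hs =>
    (hw1 s hs).continuous_fderiv one_ne_zero
  have hDw'c : ∀ s ∈ S, Continuous (fderiv ℝ (w' s)) := fun s hs =>
    (hw'1 s hs).continuous_fderiv one_ne_zero
  have hwt_c : ∀ x, ContinuousOn (fun s => w s x) S := fun x => hw.continuousOn_time x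
  have he1 : ∀ i, ‖e i‖ = 1 := fun i => e.orthonormal.1 i
  have hLe : ∀ (L : EuclideanSpace ℝ (Fin 3) →L[ℝ] EuclideanSpace ℝ (Fin 3)) (i : Fin 3),
      ‖L (e i)‖ ≤ ‖L‖ := fun L i => (L.le_opNorm (e i)).trans_eq (by rw [he1, mul_one])
  -- ## the energy `E`, the enstrophy `G`, and their productions `φ`, `ψ`
  set E : ℝ → ℝ := fun s => ∫ x, ‖w s x‖ ^ 2 with hE_def
  set G : ℝ → ℝ := fun s => VectorCalculus.gradNormSq (w s) with hG_def
  set φ : ℝ → ℝ := fun s => ∫ x, 2 * ⟪w s x, w' s x⟫ with hφ_def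
  set ψ : ℝ → ℝ := fun s => ∫ x, 2 * ∑ i, ⟪fderiv ℝ (w s) x (e i), fderiv ℝ (w' s) x (e i)⟫
    with hψ_def
  -- dominating function
  set bound : EuclideanSpace ℝ (Fin 3) → ℝ := fun x => 6 * C * C * (1 + ‖x‖) ^ (-r)
    with hbound_def
  have hbound : Integrable bound := by
    have := (integrable_one_add_norm (E := EuclideanSpace ℝ (Fin 3)) (μ := volume) hr3).const_mul
      (6 * C * C)
    simpa [hbound_def] using this
  have hprod : ∀ x : EuclideanSpace ℝ (Fin 3), ∀ {p ρ : ℝ}, 0 ≤ p → 0 ≤ ρ →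
      p ≤ C * (1 + ‖x‖) ^ (-r) → ρ ≤ C * (1 + ‖x‖) ^ (-r) →
      p * ρ ≤ C * C * (1 + ‖x‖) ^ (-r) := by
    intro x p ρ hp hρ0 hp1 hρ1
    have hw0 : 0 ≤ (1 + ‖x‖) ^ (-r) := Real.rpow_nonneg (by positivity) _
    have hw1 : (1 + ‖x‖) ^ (-r) ≤ 1 := rpow_neg_le_one x hK0
    calc p * ρ ≤ C * (1 + ‖x‖) ^ (-r) * (C * (1 + ‖x‖) ^ (-r)) :=
          mul_le_mul hp1 hρ1 hρ0 (mul_nonneg hC hw0)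
      _ ≤ C * 1 * (C * (1 + ‖x‖) ^ (-r)) := by gcongr
      _ = C * C * (1 + ‖x‖) ^ (-r) := by ring
  -- ### (B1) `E` is continuous on `S`, differentiable on the interior with derivative `φ`
  have hEle : ∀ s ∈ S, ∀ x, ‖‖w s x‖ ^ 2‖ ≤ bound x := by
    intro s hs x
    rw [norm_pow, norm_norm, sq, hbound_def]
    have := hprod x (norm_nonneg _) (norm_nonneg _) (h0 s hs x) (h0 s hs x)
    have hw0 : 0 ≤ C * C * (1 + ‖x‖) ^ (-r) := by positivity
    linarith
  have hφle : ∀ s ∈ S, ∀ x, ‖2 * ⟪w s x, w' s x⟫‖ ≤ bound x := by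
    intro s hs x
    rw [norm_mul, Real.norm_two, hbound_def]
    have h := hprod x (norm_nonneg _) (norm_nonneg _) (h0 s hs x) (ht s hs x)
    have h' : ‖⟪w s x, w' s x⟫‖ ≤ ‖w s x‖ * ‖w' s x‖ := norm_inner_le_norm _ _
    have hw0 : 0 ≤ C * C * (1 + ‖x‖) ^ (-r) := by positivity
    linarith
  have hIE : ∀ s ∈ S, Integrable (fun x => ‖w s x‖ ^ 2) := fun s hs =>
    Integrable.mono' hbound (((hwc s hs).norm).pow 2).aestronglyMeasurable
      (Eventually.of_forall (hEle s hs))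
  have hEc : ContinuousOn E S := by
    refine continuousOn_of_dominated (bound := bound) (fun s hs => ?_) (fun s hs => ?_) hbound ?_
    · exact (((hwc s hs).norm).pow 2).aestronglyMeasurable
    · exact Eventually.of_forall (hEle s hs)
    · exact Eventually.of_forall fun x => ((hwt_c x).norm).pow 2
  have hEd : ∀ s ∈ Ioo 0 T, HasDerivAt E (φ s) s := by
    intro s hs
    have hsS : s ∈ S := Ioo_subset_Icc_self hs
    have hIoo : Ioo 0 T ∈ 𝓝 s := Ioo_mem_nhds hs.1 hs.2
    have key := hasDerivAt_integral_of_dominated_loc_of_deriv_le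
      (μ := (volume : Measure (EuclideanSpace ℝ (Fin 3))))
      (F := fun σ x => ‖w σ x‖ ^ 2) (F' := fun σ x => 2 * ⟪w σ x, w' σ x⟫) (x₀ := s)
      (bound := bound) hIoo ?_ (hIE s hsS) ?_ ?_ hbound ?_
    · exact key.2
    · filter_upwards [hIoo] with σ hσ
      exact (((hwc σ (Ioo_subset_Icc_self hσ)).norm).pow 2).aestronglyMeasurable
    · exact (((hwc s hsS).inner (hw'c s hsS)).const_mul 2).aestronglyMeasurable
    · exact Eventually.of_forall fun x σ hσ => hφle σ (Ioo_subset_Icc_self hσ) x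
    · refine Eventually.of_forall fun x σ hσ => ?_
      have hσS : σ ∈ S := Ioo_subset_Icc_self hσ
      have hSσ : S ∈ 𝓝 σ := mem_of_superset (Ioo_mem_nhds hσ.1 hσ.2) Ioo_subset_Icc_self
      exact ((hw.hasDerivWithinAt_timeDerivWithin hS hσS x).hasDerivAt hSσ).norm_sq
  -- ### (B2) `G` is differentiable on the interior with derivative `ψ`
  have hGeq : ∀ s, G s = ∫ x, ∑ i, ‖fderiv ℝ (w s) x (e i)‖ ^ 2 := by
    intro s
    simp only [hG_def, VectorCalculus.gradNormSq, frobeniusNormSq_eq_sum e]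
  have hGle : ∀ s ∈ S, ∀ x, ‖∑ i, ‖fderiv ℝ (w s) x (e i)‖ ^ 2‖ ≤ bound x := by
    intro s hs x
    rw [Real.norm_of_nonneg (Finset.sum_nonneg fun i _ => sq_nonneg _), hbound_def]
    have hi : ∀ i, ‖fderiv ℝ (w s) x (e i)‖ ^ 2 ≤ C * C * (1 + ‖x‖) ^ (-r) := by
      intro i
      have hn : ‖fderiv ℝ (w s) x (e i)‖ ≤ C * (1 + ‖x‖) ^ (-r) :=
        (hLe _ i).trans (h1 s hs x)
      rw [sq]; exact hprod x (norm_nonneg _) (norm_nonneg _) hn hn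
    calc ∑ i, ‖fderiv ℝ (w s) x (e i)‖ ^ 2 ≤ ∑ _i : Fin 3, C * C * (1 + ‖x‖) ^ (-r) :=
          Finset.sum_le_sum fun i _ => hi i
      _ = 3 * (C * C * (1 + ‖x‖) ^ (-r)) := by simp
      _ ≤ 6 * C * C * (1 + ‖x‖) ^ (-r) := by
          have : 0 ≤ C * C * (1 + ‖x‖) ^ (-r) := by positivity
          linarith
  have hψle : ∀ s ∈ S, ∀ x,
      ‖2 * ∑ i, ⟪fderiv ℝ (w s) x (e i), fderiv ℝ (w' s) x (e i)⟫‖ ≤ bound x := by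
    intro s hs x
    rw [norm_mul, Real.norm_two, hbound_def]
    have hi : ∀ i, ‖⟪fderiv ℝ (w s) x (e i), fderiv ℝ (w' s) x (e i)⟫‖ ≤
        C * C * (1 + ‖x‖) ^ (-r) := by
      intro i
      exact (norm_inner_le_norm _ _).trans (hprod x (norm_nonneg _) (norm_nonneg _)
        ((hLe _ i).trans (h1 s hs x)) ((hLe _ i).trans (ht1 s hs x)))
    calc 2 * ‖∑ i, ⟪fderiv ℝ (w s) x (e i), fderiv ℝ (w' s) x (e i)⟫‖
        ≤ 2 * ∑ i, ‖⟪fderiv ℝ (w s) x (e i), fderiv ℝ (w' s) x (e i)⟫‖ := by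
          gcongr; exact norm_sum_le _ _
      _ ≤ 2 * ∑ _i : Fin 3, C * C * (1 + ‖x‖) ^ (-r) := by
          gcongr with i _; exact hi i
      _ = 6 * C * C * (1 + ‖x‖) ^ (-r) := by simp; ring
  have hGcont : ∀ s ∈ S, Continuous (fun x => ∑ i, ‖fderiv ℝ (w s) x (e i)‖ ^ 2) := fun s hs =>
    continuous_finsetSum _ fun i _ => (((hDwc s hs).clm_apply continuous_const).norm).pow 2
  have hIG : ∀ s ∈ S, Integrable (fun x => ∑ i, ‖fderiv ℝ (w s) x (e i)‖ ^ 2) := fun s hs =>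
    Integrable.mono' hbound (hGcont s hs).aestronglyMeasurable (Eventually.of_forall (hGle s hs))
  have hGd : ∀ s ∈ Ioo 0 T, HasDerivAt G (ψ s) s := by
    intro s hs
    have hsS : s ∈ S := Ioo_subset_Icc_self hs
    have hIoo : Ioo 0 T ∈ 𝓝 s := Ioo_mem_nhds hs.1 hs.2
    have key := hasDerivAt_integral_of_dominated_loc_of_deriv_le
      (μ := (volume : Measure (EuclideanSpace ℝ (Fin 3))))
      (F := fun σ x => ∑ i, ‖fderiv ℝ (w σ) x (e i)‖ ^ 2)
      (F' := fun σ x => 2 * ∑ i, ⟪fderiv ℝ (w σ) x (e i), fderiv ℝ (w' σ) x (e i)⟫) (x₀ := s)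
      (bound := bound) hIoo ?_ (hIG s hsS) ?_ ?_ hbound ?_
    · have hG' : G = fun σ => ∫ x, ∑ i, ‖fderiv ℝ (w σ) x (e i)‖ ^ 2 := funext hGeq
      rw [hG']
      exact key.2
    · filter_upwards [hIoo] with σ hσ
      exact (hGcont σ (Ioo_subset_Icc_self hσ)).aestronglyMeasurable
    · exact ((continuous_finsetSum _ fun i _ => ((hDwc s hsS).clm_apply continuous_const).inner
        ((hDw'c s hsS).clm_apply continuous_const)).const_mul 2).aestronglyMeasurable
    · exact Eventually.of_forall fun x σ hσ => hψle σ (Ioo_subset_Icc_self hσ) x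
    · refine Eventually.of_forall fun x σ hσ => ?_
      have hD : HasDerivAt (fun τ => fderiv ℝ (w τ) x) (fderiv ℝ (w' σ) x) σ :=
        hw.hasDerivAt_fderiv_slice_timeDerivWithin isOpen_Ioo Ioo_subset_Icc_self hσ x
      have hDi : ∀ i, HasDerivAt (fun τ => fderiv ℝ (w τ) x (e i)) (fderiv ℝ (w' σ) x (e i)) σ :=
        fun i => by
          simpa using hD.clm_apply (hasDerivAt_const σ (e i))
      have hsum := HasDerivAt.sum (u := Finset.univ)
        (A := fun i τ => ‖fderiv ℝ (w τ) x (e i)‖ ^ 2)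
        (A' := fun i => 2 * ⟪fderiv ℝ (w σ) x (e i), fderiv ℝ (w' σ) x (e i)⟫)
        (x := σ) fun i _ => (hDi i).norm_sq
      simp only [Finset.mul_sum]
      convert hsum using 1
      funext τ; simp
  -- ### (B3) the two fixed-time inequalities on the interior
  set Kc : ℝ := 2 * ν + a + 2 * b + (a ^ 2 + b ^ 2) / ν + 1 with hKc
  have hKc0 : 0 ≤ Kc := by rw [hKc]; positivity
  have hE0 : ∀ s ∈ Ioo 0 T, 0 ≤ E s := fun s hs => integral_nonneg fun x => sq_nonneg _
  have hG0 : ∀ s ∈ Ioo 0 T, 0 ≤ G s := fun s hs =>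
    integral_nonneg fun x => frobeniusNormSq_nonneg _
  have hφineq : ∀ s ∈ Ioo 0 T, -φ s ≤ Kc * (G s + E s) := by
    intro s hs
    have hsS : s ∈ S := Ioo_subset_Icc_self hs
    have h := neg_two_integral_inner_timeDeriv_le ha (hw2 s hsS) (hw'c s hsS) (hq s hs) (hdiv s hs)
      (heq s hs) (hf s hs) hC hr (h0 s hsS) (h1 s hsS) (h2 s hsS) (ht s hsS)
    have hG := hG0 s hs; have hE := hE0 s hs
    have h1' : (2 * ν + a) * G s ≤ Kc * G s := by
      apply mul_le_mul_of_nonneg_right _ hG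
      rw [hKc]; have : 0 ≤ (a ^ 2 + b ^ 2) / ν := by positivity
      linarith
    have h2' : (a + 2 * b) * E s ≤ Kc * E s := by
      apply mul_le_mul_of_nonneg_right _ hE
      rw [hKc]; have : 0 ≤ (a ^ 2 + b ^ 2) / ν := by positivity
      linarith [hν.le]
    simp only [hφ_def, hG_def, hE_def] at h ⊢
    linarith
  have hψineq : ∀ s ∈ Ioo 0 T, 0 < E s → ψ s * E s - G s * φ s ≤ Kc * (G s + E s) * E s := by
    intro s hs hEs
    have hsS : s ∈ S := Ioo_subset_Icc_self hs
    have h := dirichletQuotient_ineq hν (hw3 s hsS) (hw'1 s hsS) (hq s hs) (hdiv s hs)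
      (heq s hs) (hf s hs) hC hr (h0 s hsS) (h1 s hsS) (h2 s hsS) (h3 s hsS) (ht s hsS)
      (ht1 s hsS) (G s / E s)
    exact quotient_aux' (ψ := ψ s) (φ := φ s) hν hEs (hG0 s hs) ha hb h
  -- ### (B4) Temam's Lemma 6.2
  have hET : E T = 0 := by simp [hE_def, hfin]
  have hmain := LogConvexity.eq_zero_of_backward hT hKc0 hEc hEd hGd hE0 hG0 hφineq hψineq hET
  -- ### conclusion: `w t x = 0` pointwise, by continuity
  intro t htS x
  have het : E t = 0 := hmain t htS
  have hae : (fun y => ‖w t y‖ ^ 2) =ᵐ[volume] 0 :=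
    (integral_eq_zero_iff_of_nonneg (fun y => sq_nonneg _) (hIE t htS)).1 het
  have hzero : (fun y => ‖w t y‖ ^ 2) = 0 :=
    ((((hwc t htS).norm).pow 2).ae_eq_iff_eq volume continuous_const).1 hae
  have hx := congrFun hzero x
  simpa using hx

end Assembly

/-! ### §3. Two classical Navier–Stokes flows (Temam §6.2) under decay of the difference -/

section NavierStokes

open InnerProductSpace
open scoped Laplacian

/-- **Backward uniqueness for the linearised Navier–Stokes structure under finite-order decay**
(Temam 1997, Ch. III §6.2, the case `h = −B(u, w) − B(w, v)` of Lemma 6.2; Bardos–Tartar 1973).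
Let `U₁, U₂` be fields on `(0, T) × ℝ³` with `‖U₁‖ ≤ A` and `‖∇U₂‖ ≤ B`, and let `w` be a
jointly smooth divergence-free solution on `(0, T)` of `∂ₜw + (U₁·∇)w + (w·∇)U₂ = νΔw − ∇q`,
`ν > 0`, `q(t) ∈ C¹`, obeying the six uniform bounds `≤ C(1 + |x|)^{-r}`, `r > 4`, of
`eq_zero_of_perturbedStokes_backward_of_decay`. If `w(T) = 0` then `w ≡ 0` on `[0, T]`.
[cite: Temam1997, Ch. III §6.2 with Lemma 6.2 (pp. 174–175)] -/
theorem linearisedNS_backward_unique_of_decay {T ν A B C r : ℝ} (hT : 0 < T) (hν : 0 < ν)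
    (hA : 0 ≤ A) (hB : 0 ≤ B) (hC : 0 ≤ C) (hr : 4 < r)
    {U₁ U₂ w : ℝ → EuclideanSpace ℝ (Fin 3) → EuclideanSpace ℝ (Fin 3)}
    {q : ℝ → EuclideanSpace ℝ (Fin 3) → ℝ}
    (hU₁ : ∀ t ∈ Ioo 0 T, ∀ x, ‖U₁ t x‖ ≤ A) (hU₂ : ∀ t ∈ Ioo 0 T, ∀ x, ‖fderiv ℝ (U₂ t) x‖ ≤ B)
    (hw : IsSmoothSpaceTimeOn (Icc 0 T) w)
    (h0 : ∀ t ∈ Icc 0 T, ∀ x, ‖w t x‖ ≤ C * (1 + ‖x‖) ^ (-r))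
    (h1 : ∀ t ∈ Icc 0 T, ∀ x, ‖fderiv ℝ (w t) x‖ ≤ C * (1 + ‖x‖) ^ (-r))
    (h2 : ∀ t ∈ Icc 0 T, ∀ x, ‖fderiv ℝ (fderiv ℝ (w t)) x‖ ≤ C * (1 + ‖x‖) ^ (-r))
    (h3 : ∀ t ∈ Icc 0 T, ∀ x, ‖iteratedFDeriv ℝ 3 (w t) x‖ ≤ C * (1 + ‖x‖) ^ (-r))
    (ht : ∀ t ∈ Icc 0 T, ∀ x, ‖timeDerivWithin (Icc 0 T) w t x‖ ≤ C * (1 + ‖x‖) ^ (-r))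
    (ht1 : ∀ t ∈ Icc 0 T, ∀ x,
      ‖fderiv ℝ (timeDerivWithin (Icc 0 T) w t) x‖ ≤ C * (1 + ‖x‖) ^ (-r))
    (hq : ∀ t ∈ Ioo 0 T, ContDiff ℝ 1 (q t))
    (hdiv : ∀ t ∈ Ioo 0 T, VectorCalculus.IsDivFree (w t))
    (heq : ∀ t ∈ Ioo 0 T, ∀ x,
      timeDerivWithin (Icc 0 T) w t x + convect (U₁ t) (w t) x + convect (w t) (U₂ t) x =
        ν • (Δ (w t)) x - gradient (q t) x)
    (hfin : ∀ x, w T x = 0) : ∀ t ∈ Icc 0 T, ∀ x, w t x = 0 := by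
  refine eq_zero_of_perturbedStokes_backward_of_decay hT hν hA hB hC hr hw h0 h1 h2 h3 ht ht1 hq
    hdiv (f := fun t x => -(convect (U₁ t) (w t) x + convect (w t) (U₂ t) x)) (fun t ht' x => ?_)
    (fun t ht' x => ?_) hfin
  · rw [← heq t ht' x]; abel
  · rw [norm_neg, convect_apply, convect_apply]
    refine (norm_add_le _ _).trans ?_
    have e1 : ‖fderiv ℝ (w t) x (U₁ t x)‖ ≤ A * ‖fderiv ℝ (w t) x‖ :=
      (ContinuousLinearMap.le_opNorm _ _).trans (by
        rw [mul_comm]; exact mul_le_mul_of_nonneg_right (hU₁ t ht' x) (norm_nonneg _))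
    have e2 : ‖fderiv ℝ (U₂ t) x (w t x)‖ ≤ B * ‖w t x‖ :=
      (ContinuousLinearMap.le_opNorm _ _).trans
        (mul_le_mul_of_nonneg_right (hU₂ t ht' x) (norm_nonneg _))
    exact add_le_add e1 e2

/-- **Backward uniqueness of classical Navier–Stokes flows on `ℝ³` under finite-order decay of
the difference** (Temam 1997, Ch. III §6.2: "if `u(T) = v(T)` then `u(t) = v(t)` for all
`t ∈ [0, T]`", by the log-convexity Lemma 6.2 going back to Bardos–Tartar 1973; whole-space
classical rendering). Let `(u₁, p₁)`, `(u₂, p₂)` be classical solutions of the forced Navier–Stokes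
equations on `[0, T] × ℝ³` with the same viscosity `ν > 0` and the same force, with
`‖u₁‖ ≤ A` and `‖∇u₂‖ ≤ B` on `(0, T) × ℝ³` (Temam's `k = k(‖u‖_∞, ‖∇v‖_∞)` in (6.17)), and
suppose the difference `w = u₁ − u₂` obeys the six uniform polynomial bounds
`‖w‖, ‖∇w‖, ‖∇²w‖, ‖∇³w‖, ‖∂ₜw‖, ‖∇∂ₜw‖ ≤ C(1 + |x|)^{-r}` on `[0, T] × ℝ³` for some `r > 4`.
If `u₁(T) = u₂(T)` then `u₁(t) = u₂(t)` for all `t ∈ [0, T]`. (The difference solves the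
linearised structure of `linearisedNS_backward_unique_of_decay` with `U₁ = u₁`, `U₂ = u₂`,
`q = p₁ − p₂`; compare `IsClassicalNSSolutionOn.backward_unique`, the same conclusion under
uniform rapid decay of both flows.) [cite: Temam1997, Ch. III §6.2 with Lemma 6.2 (pp. 172–175)] -/
theorem IsClassicalNSSolutionOn.backward_unique_of_decay {T ν A B C r : ℝ} (hT : 0 < T)
    (hν : 0 < ν) (hA : 0 ≤ A) (hB : 0 ≤ B) (hC : 0 ≤ C) (hr : 4 < r)
    {f u₁ u₂ : ℝ → EuclideanSpace ℝ (Fin 3) → EuclideanSpace ℝ (Fin 3)}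
    {p₁ p₂ : ℝ → EuclideanSpace ℝ (Fin 3) → ℝ}
    (hs₁ : IsClassicalNSSolutionOn (Icc 0 T) ν f u₁ p₁)
    (hs₂ : IsClassicalNSSolutionOn (Icc 0 T) ν f u₂ p₂)
    (hU₁ : ∀ t ∈ Ioo 0 T, ∀ x, ‖u₁ t x‖ ≤ A) (hU₂ : ∀ t ∈ Ioo 0 T, ∀ x, ‖fderiv ℝ (u₂ t) x‖ ≤ B)
    (h0 : ∀ t ∈ Icc 0 T, ∀ x, ‖u₁ t x - u₂ t x‖ ≤ C * (1 + ‖x‖) ^ (-r))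
    (h1 : ∀ t ∈ Icc 0 T, ∀ x, ‖fderiv ℝ (fun y => u₁ t y - u₂ t y) x‖ ≤ C * (1 + ‖x‖) ^ (-r))
    (h2 : ∀ t ∈ Icc 0 T, ∀ x,
      ‖fderiv ℝ (fderiv ℝ (fun y => u₁ t y - u₂ t y)) x‖ ≤ C * (1 + ‖x‖) ^ (-r))
    (h3 : ∀ t ∈ Icc 0 T, ∀ x,
      ‖iteratedFDeriv ℝ 3 (fun y => u₁ t y - u₂ t y) x‖ ≤ C * (1 + ‖x‖) ^ (-r))
    (ht : ∀ t ∈ Icc 0 T, ∀ x,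
      ‖timeDerivWithin (Icc 0 T) (fun s y => u₁ s y - u₂ s y) t x‖ ≤ C * (1 + ‖x‖) ^ (-r))
    (ht1 : ∀ t ∈ Icc 0 T, ∀ x,
      ‖fderiv ℝ (timeDerivWithin (Icc 0 T) (fun s y => u₁ s y - u₂ s y) t) x‖ ≤
        C * (1 + ‖x‖) ^ (-r))
    (hfin : u₁ T = u₂ T) : ∀ t ∈ Icc 0 T, u₁ t = u₂ t := by
  have hS : UniqueDiffOn ℝ (Icc 0 T) := uniqueDiffOn_Icc hT
  have hsm₁ := hs₁.smooth_velocity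
  have hsm₂ := hs₂.smooth_velocity
  have hw : IsSmoothSpaceTimeOn (Icc 0 T) (fun s x => u₁ s x - u₂ s x) := hsm₁.sub hsm₂
  -- slice regularity
  have hc₁ : ∀ s ∈ Icc 0 T, ContDiff ℝ 2 (u₁ s) := fun s hs =>
    contDiff_infty.1 (hs₁.contDiff_velocity hs) 2
  have hc₂ : ∀ s ∈ Icc 0 T, ContDiff ℝ 2 (u₂ s) := fun s hs =>
    contDiff_infty.1 (hs₂.contDiff_velocity hs) 2
  have hdf₁ : ∀ s ∈ Icc 0 T, Differentiable ℝ (u₁ s) := fun s hs =>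
    (hc₁ s hs).differentiable two_ne_zero
  have hdf₂ : ∀ s ∈ Icc 0 T, Differentiable ℝ (u₂ s) := fun s hs =>
    (hc₂ s hs).differentiable two_ne_zero
  have hP₁ : ∀ s ∈ Icc 0 T, ContDiff ℝ 1 (p₁ s) := fun s hs =>
    contDiff_infty.1 (hs₁.contDiff_pressure hs) 1
  have hP₂ : ∀ s ∈ Icc 0 T, ContDiff ℝ 1 (p₂ s) := fun s hs =>
    contDiff_infty.1 (hs₂.contDiff_pressure hs) 1
  -- the pressure difference, incompressibility of the difference
  have hq : ∀ s ∈ Ioo 0 T, ContDiff ℝ 1 (fun x => p₁ s x - p₂ s x) := fun s hs =>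
    (hP₁ s (Ioo_subset_Icc_self hs)).sub (hP₂ s (Ioo_subset_Icc_self hs))
  have hdiv : ∀ s ∈ Ioo 0 T, VectorCalculus.IsDivFree (fun x => u₁ s x - u₂ s x) := by
    intro s hs x
    have hsS := Ioo_subset_Icc_self hs
    have e : VectorCalculus.divergence (fun x => u₁ s x - u₂ s x) x =
        VectorCalculus.divergence (u₁ s) x - VectorCalculus.divergence (u₂ s) x := by
      simp only [VectorCalculus.divergence, fderiv_fun_sub (hdf₁ s hsS x) (hdf₂ s hsS x),
        ContinuousLinearMap.toLinearMap_sub, map_sub]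
    rw [e, hs₁.divFree s hsS x, hs₂.divFree s hsS x, sub_zero]
  -- the linearised equation for the difference
  have heq : ∀ s ∈ Ioo 0 T, ∀ x,
      timeDerivWithin (Icc 0 T) (fun s x => u₁ s x - u₂ s x) s x
        + convect (u₁ s) (fun x => u₁ s x - u₂ s x) x
        + convect (fun x => u₁ s x - u₂ s x) (u₂ s) x =
      ν • (Δ (fun x => u₁ s x - u₂ s x)) x - gradient (fun x => p₁ s x - p₂ s x) x := by
    intro s hs x
    have hsS := Ioo_subset_Icc_self hs
    have e1 := hs₁.momentum s hsS x
    have e2 := hs₂.momentum s hsS x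
    rw [convect_apply] at e1 e2
    have hwt : timeDerivWithin (Icc 0 T) (fun s x => u₁ s x - u₂ s x) s x =
        timeDerivWithin (Icc 0 T) u₁ s x - timeDerivWithin (Icc 0 T) u₂ s x :=
      ((hsm₁.hasDerivWithinAt_timeDerivWithin hS hsS x).sub
        (hsm₂.hasDerivWithinAt_timeDerivWithin hS hsS x)).derivWithin (hS s hsS)
    have hΔ : (Δ (fun x => u₁ s x - u₂ s x)) x = (Δ (u₁ s)) x - (Δ (u₂ s)) x :=
      laplacian_sub_apply_of_contDiff (hc₁ s hsS) (hc₂ s hsS) x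
    have hgq : gradient (fun x => p₁ s x - p₂ s x) x = gradient (p₁ s) x - gradient (p₂ s) x :=
      gradient_sub_apply ((hP₁ s hsS).differentiable one_ne_zero)
        ((hP₂ s hsS).differentiable one_ne_zero) x
    have hDw : fderiv ℝ (fun x => u₁ s x - u₂ s x) x = fderiv ℝ (u₁ s) x - fderiv ℝ (u₂ s) x :=
      fderiv_fun_sub (hdf₁ s hsS x) (hdf₂ s hsS x)
    rw [hwt, hΔ, hgq, convect_apply, convect_apply, hDw, FunLike.coe_sub, Pi.sub_apply,
      map_sub, smul_sub, eq_sub_of_add_eq e1, eq_sub_of_add_eq e2]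
    abel
  have hfin' : ∀ x, (fun s x => u₁ s x - u₂ s x) T x = 0 := fun x => by
    simp [hfin]
  have hmain := linearisedNS_backward_unique_of_decay hT hν hA hB hC hr hU₁ hU₂ hw h0 h1 h2 h3
    ht ht1 hq hdiv heq hfin'
  intro t ht'
  funext x
  exact sub_eq_zero.1 (hmain t ht' x)

/-- **The symmetric form: both flows bounded with bounded gradient.** Two classical solutions of
the forced Navier–Stokes equations on `[0, T] × ℝ³` (same `ν > 0`, same force), BOTH bounded with
bounded gradient on the open slab (`‖uᵢ‖ ≤ M`, `‖∇uᵢ‖ ≤ M`), whose difference obeys the six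
uniform polynomial bounds `≤ C(1 + |x|)^{-r}`, `r > 4`, on the closed slab, and which agree at
time `T`, agree on `[0, T]` (the case `A = B = M` of `backward_unique_of_decay`; recorded in the
shape used by consumers that carry a single sup bound for value and gradient of each flow).
[cite: Temam1997, Ch. III §6.2 with Lemma 6.2 (pp. 172–175)] -/
theorem IsClassicalNSSolutionOn.backward_unique_of_decay_symm {T ν M C r : ℝ} (hT : 0 < T)
    (hν : 0 < ν) (hM : 0 ≤ M) (hC : 0 ≤ C) (hr : 4 < r)
    {f u₁ u₂ : ℝ → EuclideanSpace ℝ (Fin 3) → EuclideanSpace ℝ (Fin 3)}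
    {p₁ p₂ : ℝ → EuclideanSpace ℝ (Fin 3) → ℝ}
    (hs₁ : IsClassicalNSSolutionOn (Icc 0 T) ν f u₁ p₁)
    (hs₂ : IsClassicalNSSolutionOn (Icc 0 T) ν f u₂ p₂)
    (hb₁ : ∀ t ∈ Ioo 0 T, ∀ x, ‖u₁ t x‖ ≤ M ∧ ‖fderiv ℝ (u₁ t) x‖ ≤ M)
    (hb₂ : ∀ t ∈ Ioo 0 T, ∀ x, ‖u₂ t x‖ ≤ M ∧ ‖fderiv ℝ (u₂ t) x‖ ≤ M)
    (h0 : ∀ t ∈ Icc 0 T, ∀ x, ‖u₁ t x - u₂ t x‖ ≤ C * (1 + ‖x‖) ^ (-r))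
    (h1 : ∀ t ∈ Icc 0 T, ∀ x, ‖fderiv ℝ (fun y => u₁ t y - u₂ t y) x‖ ≤ C * (1 + ‖x‖) ^ (-r))
    (h2 : ∀ t ∈ Icc 0 T, ∀ x,
      ‖fderiv ℝ (fderiv ℝ (fun y => u₁ t y - u₂ t y)) x‖ ≤ C * (1 + ‖x‖) ^ (-r))
    (h3 : ∀ t ∈ Icc 0 T, ∀ x,
      ‖iteratedFDeriv ℝ 3 (fun y => u₁ t y - u₂ t y) x‖ ≤ C * (1 + ‖x‖) ^ (-r))
    (ht : ∀ t ∈ Icc 0 T, ∀ x,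
      ‖timeDerivWithin (Icc 0 T) (fun s y => u₁ s y - u₂ s y) t x‖ ≤ C * (1 + ‖x‖) ^ (-r))
    (ht1 : ∀ t ∈ Icc 0 T, ∀ x,
      ‖fderiv ℝ (timeDerivWithin (Icc 0 T) (fun s y => u₁ s y - u₂ s y) t) x‖ ≤
        C * (1 + ‖x‖) ^ (-r))
    (hfin : u₁ T = u₂ T) : ∀ t ∈ Icc 0 T, u₁ t = u₂ t :=
  hs₁.backward_unique_of_decay hT hν hM hM hC hr hs₂ (fun t ht' x => (hb₁ t ht' x).1)
    (fun t ht' x => (hb₂ t ht' x).2) h0 h1 h2 h3 ht ht1 hfin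

end NavierStokes

end Literature.Analysis.FluidPDE

end
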